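import Literature.AlgebraicGeometry.Modules.SerreTwistVanishingIdealChart
import Literature.AlgebraicGeometry.Morphisms.ProjectiveSubschemeCutOutByDegreeEquations
import Literature.AlgebraicGeometry.Modules.SerreTwistMonomialSections
import Literature.AlgebraicGeometry.Morphisms.CechH1ProjectiveFinite
import HarnessLib

/-!
# A closed subscheme of `ℙ^r_k` with given Hilbert polynomial is the vanishing locus of its degree-`d` equations, read in `𝒪(d)`

Topic `Literature/AlgebraicGeometry/Morphisms`, namespace `Literature.AlgebraicGeometry.Morphisms.ProjCech`.  THEOREMS ONLY (no definition,
no instance, no notation, no named fact, no `sorry`).  Cell `hodgecm-mathlib` (D-0151), F-DAG leaf F-5 (5d) (director s232; B-plan1 (g17)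
09:09:40Z), FILE 4 of the (II′) MONO wrapper (author B-p20 (g12)): the POINTWISE `hcut` of ★ `Modules/SubbundleEquationsBaseChange`
§4 in the sheaf letter — assembling ★ `Morphisms/ProjectiveSubschemeCutOutByDegreeEquations` (the chart ideal of `Z` is generated by the
dehomogenised degree-`d` forms of its homogeneous ideal) with ★ `Modules/SerreTwistVanishingIdealChart` (the chart ideal of `V(v♭)` is
generated by the coordinates of the equations).  Count-neutral Mathlib-side capital: HC_CM is proved only modulo the 7 printed
citations until rung 0 closes — nothing here is about HC.

THE PRINT.  [Mumford1966CurvesSurface] Lecture 15 (V.) (pp. 107–108): «the image of `p^*(K)` in `o(m₀)` is exactly `o(-D + m₀)`; therefore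
`𝓘` is `o(-D)`» — on ONE fibre: a closed subscheme `ι : X₀ ↪ ℙ^r_k` with Hilbert polynomial `QZ` is, for `d ≥ B(QZ)`, the VANISHING LOCUS
of any family of equations `v : K₀ ⟶ π_* 𝒪_{ℙ}(d)` whose chart coordinates on every `D₊(x_j)` are exactly the dehomogenised forms `f_d/x_j^d`,
`f ∈ 𝔞 = idealZ ι` ([Hartshorne1977] II Cor. 5.16 (a), Ex. 5.10).  Here `𝒪_ℙ(d) := SerreTwist.twistMod (𝟙 ℙ) (unitModule ℙ) d` (the twist
model of ★ (γ0) `SerreTwistMonomialSections` at `ι := 𝟙`, whose charts are the `D₊(x_j)` and whose chart evaluation `evalRing (𝟙 ℙ) {j}`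
is the identification `B_{{j}} ≅ Γ(ℙ, D₊(x_j))`).

* §1 `app_evalRing_id`, `evalRing_id_surjective` / `…_injective`, **`ker_ideal_Dplus_eq_map_ker_evalRing`** — the ideal of `X₀` on
  `D₊(x_j)` (Mathlib `Scheme.Hom.ker`) is the image of `ker (evalRing ι {j})` under `evalRing (𝟙 ℙ) {j}`; with FILE 3:
  **`ker_ideal_Dplus_eq_span_of_hilbertPolynomial`** — it is generated by the `evalRing (𝟙 ℙ) {j} (f_d/x_j^d)`, `f ∈ 𝔞`;
* §2 `chartEquiv_map_monomialSection` — the `j`-coordinate of the monomial section `μ_w` of `𝒪(d)` is the chart function `wordFun j w`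
  (★ `comp_monomialSection_eq_map_wordFun`), for any `ι : Z ⟶ ℙ^r_A`;
* §3 **`ker_eq_vanishingIdeal_transpose_of_hilbertPolynomial`** — THE POINTWISE MONO in the sheaf letter: if the `j`-coordinates of the
  equations `v(k)`, `k ∈ Γ(K₀)`, are exactly the `evalRing (𝟙 ℙ) {j} (f_d/x_j^d)`, `f ∈ 𝔞`, on every chart, then `𝓘_{X₀} = V(v♭)`.

## References
* [Mumford1966CurvesSurface] D. Mumford, *Lectures on Curves on an Algebraic Surface* (1966), Lecture 15 (IV.)–(V.) (pp. 107–108).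
* [Hartshorne1977] R. Hartshorne, *Algebraic Geometry* (1977), II Cor. 5.16 (a) (p. 119), II Ex. 5.10 (p. 125), II Prop. 5.12 (p. 117),
  II Prop. 2.5 (b) (p. 76).
-/

noncomputable section

-- `TopCat.Presheaf`/`Scheme.Modules` are not reducible (as in Mathlib's `AlgebraicGeometry/Modules`).
set_option backward.isDefEq.respectTransparency false

universe u

-- needed to MENTION Mathlib's `Proj.awayToSection (grading A r)` / `Proj.basicOpenIsoAway` (as in ★ `Morphisms/CechH1Projective`)
attribute [local instance] MvPolynomial.gradedAlgebra

open CategoryTheory CategoryTheory.Limits AlgebraicGeometry TopologicalSpace Opposite Polynomial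
open Literature.Algebra.Homology Literature.Algebra.Homology.LaurentCech
open Literature.AlgebraicGeometry.Modules Literature.AlgebraicGeometry.Modules.SerreTwist

namespace Literature.AlgebraicGeometry.Morphisms

namespace ProjCech

/-! ## §1 The ideal of `X₀` on a standard chart, in `Γ(ℙ, D₊(x_j))` -/

section Chart

variable {A : Type u} [CommRing A] {r : ℕ} {X₀ : Scheme.{u}} (ι : X₀ ⟶ PP A r)

/-- `ι^♯` of the chart function `evalRing (𝟙 ℙ) {j} b ∈ Γ(ℙ, D₊(x_j))` is `evalRing ι {j} b ∈ Γ(X₀, X₀ ∩ D₊(x_j))` (both are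
`b ∈ B_{{j}} = (P_{x_j})₀` read as a function, ★ `evalRing_apply`). [cite: Hartshorne1977, II Prop. 2.5 (b) (p. 76)] -/
theorem app_evalRing_id (j : Fin (r + 1)) (b : Bsub A r {j}) :
    ι.app (Dplus A r {j}) (show Γ(PP A r, Dplus A r {j}) from evalRing (𝟙 (PP A r)) {j} b) = evalRing ι {j} b := by
  rw [evalRing_apply, evalRing_apply]
  rfl

/-- `evalRing (𝟙 ℙ) {j} : B_{{j}} → Γ(ℙ, D₊(x_j))` is surjective (★ `evalRing_surjective`). [cite: Hartshorne1977, II Prop. 2.5 (b) (p. 76)] -/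
theorem evalRing_id_surjective (j : Fin (r + 1)) : Function.Surjective (evalRing (𝟙 (PP A r)) {j}) :=
  evalRing_surjective (𝟙 (PP A r)) {j} (Finset.singleton_nonempty j)

/-- `evalRing (𝟙 ℙ) {j} : B_{{j}} → Γ(ℙ, D₊(x_j))` is injective (Mathlib `Proj.basicOpenIsoAway`: `Γ(ℙ, D₊(f)) ≅ (P_f)₀`).
[cite: Hartshorne1977, II Prop. 2.5 (b) (p. 76)] -/
theorem evalRing_id_injective (j : Fin (r + 1)) : Function.Injective (evalRing (𝟙 (PP A r)) {j}) := by
  intro b b' h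
  rw [evalRing_apply, evalRing_apply] at h
  change Proj.awayToSection (grading A r) (Xs A {j}) ((awayEquiv A r {j}).symm b) =
    Proj.awayToSection (grading A r) (Xs A {j}) ((awayEquiv A r {j}).symm b') at h
  have hinj : Function.Injective (Proj.awayToSection (grading A r) (Xs A {j})) :=
    (ConcreteCategory.bijective_of_isIso
      (Proj.basicOpenIsoAway (grading A r) (Xs A {j}) (Xs_mem {j}) (Finset.card_pos.mpr (Finset.singleton_nonempty j))).hom).1
  exact (awayEquiv A r {j}).symm.injective (hinj h)

/-- **The ideal of `X₀` on `D₊(x_j)` is the image of `ker (B_{{j}} → Γ(X₀, X₀ ∩ D₊(x_j)))`** under the identification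
`evalRing (𝟙 ℙ) {j} : B_{{j}} ≅ Γ(ℙ, D₊(x_j))` (Mathlib `Scheme.Hom.ker_apply`: the ideal sheaf of `ι` on an affine open is
`ker ι^♯`). [cite: Hartshorne1977, II Cor. 5.16 (a) (p. 119)] -/
theorem ker_ideal_Dplus_eq_map_ker_evalRing [IsClosedImmersion ι] (j : Fin (r + 1)) :
    ι.ker.ideal ⟨Dplus A r {j}, isAffineOpen_Zop (𝟙 (PP A r)) (Finset.singleton_nonempty j)⟩ =
      Ideal.map (evalRing (𝟙 (PP A r)) {j}) (RingHom.ker (evalRing ι {j})) := by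
  apply le_antisymm
  · intro g hg
    rw [Scheme.Hom.ker_apply] at hg
    obtain ⟨b, rfl⟩ := evalRing_id_surjective j g
    refine Ideal.mem_map_of_mem _ ?_
    rw [RingHom.mem_ker, ← app_evalRing_id ι j b]
    exact hg
  · rw [Ideal.map_le_iff_le_comap]
    intro b hb
    rw [Ideal.mem_comap, Scheme.Hom.ker_apply, RingHom.mem_ker]
    change ι.app (Dplus A r {j}) (show Γ(PP A r, Dplus A r {j}) from evalRing (𝟙 (PP A r)) {j} b) = 0
    rw [app_evalRing_id]
    exact hb

end Chart

section ChartField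

variable {k : Type u} [Field k] [Infinite k] {r : ℕ} {X₀ : Scheme.{u}} (ι : X₀ ⟶ PP k r) [IsClosedImmersion ι]

/-- **The ideal of `X₀ ⊂ ℙ^r_k` on `D₊(x_j)` is generated by the dehomogenised degree-`d` forms of its homogeneous ideal** (`k` infinite,
`r ≥ 1`, `X₀` with Hilbert polynomial `QZ`, `d ≥ B(QZ)`; ★ `ker_evalRing_eq_span_fracB_of_hilbertPolynomial` moved into `Γ(ℙ, D₊(x_j))`).
[cite: Mumford1966CurvesSurface, Lecture 15 (IV.)–(V.) (pp. 107–108)] [cite: Hartshorne1977, II Cor. 5.16 (a) (p. 119)] -/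
theorem ker_ideal_Dplus_eq_span_of_hilbertPolynomial (hr : 1 ≤ r) {QZ : ℚ[X]}
    (hQZ : ∀ n : ℤ, ((∑ q ∈ Finset.range (r + 1), (-1 : ℤ) ^ q *
      (Module.finrank k ((quot (fun _ : Unit => (0 : ℤ)) (KZ ι) n).homology q) : ℤ) : ℤ) : ℚ) = QZ.eval (n : ℚ))
    {d : ℕ} (hd : regularityBound (preHilbertPoly ℚ r 0) 0 (preHilbertPoly ℚ r 0 - QZ) ≤ (d : ℤ)) (j : Fin (r + 1)) :
    ι.ker.ideal ⟨Dplus k r {j}, isAffineOpen_Zop (𝟙 (PP k r)) (Finset.singleton_nonempty j)⟩ =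
      Ideal.span (Set.range fun f : idealZ ι =>
        show Γ(PP k r, Dplus k r {j}) from evalRing (𝟙 (PP k r)) {j} (fracB k j d (f : P k r))) := by
  rw [ker_ideal_Dplus_eq_map_ker_evalRing, ker_evalRing_eq_span_fracB_of_hilbertPolynomial ι hr hQZ hd j, Ideal.map_span,
    ← Set.range_comp]
  rfl

end ChartField

/-! ## §2 The coordinate of a monomial section is the chart function -/

section Coordinate

variable {A : Type u} [CommRing A] {r : ℕ} {Z : Scheme.{u}} (ι : Z ⟶ PP A r)

/-- **The `j`-coordinate of the monomial section `μ_w` of `𝒪_Z(d)` on `Z_j` is the chart function `μ_w / x_j^d = wordFun j w`**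
(★ `comp_monomialSection_eq_map_wordFun`, ★ `chartEquiv_apply`). [cite: Hartshorne1977, II Prop. 5.12 (p. 117)] -/
theorem chartEquiv_map_monomialSection (d : ℕ) (w : Fin d → Fin (r + 1)) (j : Fin (r + 1)) :
    chartEquiv ι (unitModule Z) d (le_refl (Zop ι {j}))
        ((twistMod ι (unitModule Z) d).presheaf.map (homOfLE (le_top : Zop ι {j} ≤ ⊤)).op (monomialSection ι d w)) =
      wordFun ι j w := by
  rw [chartEquiv_apply, SerreTwist.comp_map]
  change (unitModule Z).presheaf.map _ ((unitModule Z).presheaf.map _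
    (show Γ(Z, ⊤ ⊓ Zop ι {j}) from comp ι (unitModule Z) (monomialSection ι d w) j)) = _
  rw [comp_monomialSection_eq_map_wordFun]
  change ((Z.presheaf.map _ ≫ Z.presheaf.map _) ≫ Z.presheaf.map _) (wordFun ι j w) = wordFun ι j w
  rw [← CategoryTheory.Functor.map_comp, ← CategoryTheory.Functor.map_comp,
    show ((homOfLE (inf_le_right : ⊤ ⊓ Zop ι {j} ≤ Zop ι {j})).op ≫ _) ≫ _ = 𝟙 (op (Zop ι {j})) from Subsingleton.elim _ _,
    CategoryTheory.Functor.map_id]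
  rfl

end Coordinate

/-! ## §3 The pointwise MONO in the sheaf letter -/

section Pointwise

variable {k : Type u} [Field k] [Infinite k] {r : ℕ} {X₀ : Scheme.{u}} (ι : X₀ ⟶ PP k r) [IsClosedImmersion ι]
  {K₀ : (Spec (CommRingCat.of k)).Modules} (d : ℕ)
  (v : K₀ ⟶ (Scheme.Modules.pushforward (toSpec k r)).obj (twistMod (𝟙 (PP k r)) (unitModule (PP k r)) d))

/-- **A CLOSED SUBSCHEME OF `ℙ^r_k` WITH HILBERT POLYNOMIAL `QZ` IS THE VANISHING LOCUS OF ITS DEGREE-`d` EQUATIONS** (`k` infinite, `r ≥ 1`,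
`d ≥ B(QZ)`; [Mumford1966CurvesSurface] Lect. 15 (V.) on one fibre): let `v : K₀ ⟶ π_* 𝒪_ℙ(d)` (`π : ℙ^r_k → Spec k`, `𝒪_ℙ(d)` the twist
model along `𝟙 ℙ`) be equations whose `j`-coordinates on every chart `D₊(x_j)` are exactly the dehomogenised degree-`d` forms of the
homogeneous ideal `𝔞` of `X₀` (`hv`, `hv'`).  Then the ideal sheaf of `ι : X₀ ↪ ℙ^r_k` IS the vanishing ideal of the transposed equations
`v♭ : π^* K₀ ⟶ 𝒪_ℙ(d)`: both have, on every `D₊(x_j)`, the ideal generated by these functions (§1 and ★ `vanishingIdeal_transpose_ideal_Zop_eq_span`).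
[cite: Mumford1966CurvesSurface, Lecture 15 (IV.)–(V.) (pp. 107–108)] [cite: Hartshorne1977, II Cor. 5.16 (a) (p. 119)] -/
theorem ker_eq_vanishingIdeal_transpose_of_hilbertPolynomial (hr : 1 ≤ r) {QZ : ℚ[X]}
    (hQZ : ∀ n : ℤ, ((∑ q ∈ Finset.range (r + 1), (-1 : ℤ) ^ q *
      (Module.finrank k ((quot (fun _ : Unit => (0 : ℤ)) (KZ ι) n).homology q) : ℤ) : ℤ) : ℚ) = QZ.eval (n : ℚ))
    (hd : regularityBound (preHilbertPoly ℚ r 0) 0 (preHilbertPoly ℚ r 0 - QZ) ≤ (d : ℤ)) (hK : IsAffineLocalizing K₀)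
    (hv : ∀ (x : Γ(K₀, ⊤)) (j : Fin (r + 1)), ∃ f ∈ idealZ ι,
      chartEquiv (𝟙 (PP k r)) (unitModule (PP k r)) d (le_refl (Zop (𝟙 (PP k r)) {j}))
          ((twistMod (𝟙 (PP k r)) (unitModule (PP k r)) d).presheaf.map
            (homOfLE (le_top : Zop (𝟙 (PP k r)) {j} ≤ toSpec k r ⁻¹ᵁ ⊤)).op
            (show Γ(twistMod (𝟙 (PP k r)) (unitModule (PP k r)) d, toSpec k r ⁻¹ᵁ ⊤) from v.app ⊤ x)) =
        evalRing (𝟙 (PP k r)) {j} (fracB k j d f))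
    (hv' : ∀ f ∈ idealZ ι, ∀ j : Fin (r + 1), ∃ x : Γ(K₀, ⊤),
      chartEquiv (𝟙 (PP k r)) (unitModule (PP k r)) d (le_refl (Zop (𝟙 (PP k r)) {j}))
          ((twistMod (𝟙 (PP k r)) (unitModule (PP k r)) d).presheaf.map
            (homOfLE (le_top : Zop (𝟙 (PP k r)) {j} ≤ toSpec k r ⁻¹ᵁ ⊤)).op
            (show Γ(twistMod (𝟙 (PP k r)) (unitModule (PP k r)) d, toSpec k r ⁻¹ᵁ ⊤) from v.app ⊤ x)) =
        evalRing (𝟙 (PP k r)) {j} (fracB k j d f)) :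
    ι.ker = vanishingIdeal (((Scheme.Modules.pullbackPushforwardAdjunction (toSpec k r)).homEquiv K₀ _).symm v) := by
  refine Scheme.IdealSheafData.ext_of_iSup_eq_top
    (fun j : Fin (r + 1) => (⟨Dplus k r {j}, isAffineOpen_Zop (𝟙 (PP k r)) (Finset.singleton_nonempty j)⟩ : (PP k r).affineOpens))
    (iSup_cover_eq_top (𝟙 (PP k r))) fun j => ?_
  rw [ker_ideal_Dplus_eq_span_of_hilbertPolynomial ι hr hQZ hd j]
  change _ = (vanishingIdeal _).ideal ⟨Zop (𝟙 (PP k r)) {j}, isAffineOpen_Zop (𝟙 (PP k r)) (Finset.singleton_nonempty j)⟩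
  rw [vanishingIdeal_transpose_ideal_Zop_eq_span (𝟙 (PP k r)) (toSpec k r) d v hK j]
  apply le_antisymm
  · rw [Ideal.span_le]
    rintro _ ⟨f, rfl⟩
    obtain ⟨x, hx⟩ := hv' f f.2 j
    exact Ideal.subset_span ⟨x, hx⟩
  · rw [Ideal.span_le]
    rintro _ ⟨x, rfl⟩
    obtain ⟨f, hf, hx⟩ := hv x j
    exact Ideal.subset_span ⟨⟨f, hf⟩, hx.symm⟩

end Pointwise

end ProjCech

end Literature.AlgebraicGeometry.Morphisms

end
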